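import Literature.MathematicalPhysics.KineticTheory.LangevinChainConfined
import Literature.MathematicalPhysics.KineticTheory.LangevinChainKalman
import HarnessLib

/-!
# Kalman's rank condition for the linearised chain with `C²` potentials and nondegenerate coupling

Topic `Literature/MathematicalPhysics/KineticTheory` (trunk T-KINETIC). `LangevinChainKalman.lean`
proved, for the pinned chain `pinnedChain ω₂ lam β γ` (smooth potentials, `V''(0) = 1`), that the
Kalman vectors `Aᵏ(0, e₀)`, `A = DY(0)`, of the Langevin drift linearised at the equilibrium span
phase space. The proof used only the tridiagonal structure of `Hess Φ(0)` and `V''(0) ≠ 0` — not the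
pinning. This file records the general statement, for every oscillator chain with `C²` potentials
(the regularity of the Hairer–Mattingly pinning `|q|^{2k}/2k`, `k > 3/2`, whose linearisation at `0`
has NO pinning term: `U''(0) = 0`) and nondegenerate coupling `V''(0) ≠ 0`:

* `OscillatorChain.hasLineDerivAt_drift_unitP₂`, `….hasLineDerivAt_drift_unitQ₂`,
  `….fderiv_drift_apply₂` — the derivative of the drift `DY(x) v = (v.2, -Hess Φ(q) v.1 - γ1_B v.2)`
  for `C²` potentials (the `C^∞` versions are in `LangevinChainHormander.lean`);
* `OscillatorChain.eq_zero_of_forall_pow_unitP_zero₂` — **Kalman's condition from the left bath**: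
  a linear functional annihilating all `Aᵏ(0, e₀)` vanishes (peeling from the left as in
  `pinnedChain_eq_zero_of_forall_pow_unitP_zero`, the sub-diagonal `Hess Φ(0)_{s+1,s} = -V''(0)`
  being nonzero).

This is the controllability input of the Hörmander-free local minorisation of the transition
probabilities near the equilibrium (`LangevinChainLinearControl.lean`,
`LangevinChainLocalMinorization.lean` for the pinned chain), here prepared for chains with
confining, finitely differentiable potentials.

## References

* E. D. Sontag, *Mathematical Control Theory* (1998), §3.3; J.-P. Eckmann, C.-A. Pillet,
  L. Rey-Bellet, CMP **201** (1999), §3 (controllability of oscillator chains from the ends).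
-/

noncomputable section

open Filter Topology Set Finset

namespace Literature.MathematicalPhysics.KineticTheory.HeatConduction

variable {N : ℕ}

namespace OscillatorChain

variable (P : OscillatorChain)

/-! ### The derivative of the drift for `C²` potentials -/

/-- `∂Y/∂p_j = (e_j, -γ ([j = 0] + [j = N-1]) e_j)` (`C²` potentials suffice: only `Φ'` enters `Y`).
[folklore] -/
theorem hasLineDerivAt_drift_unitP₂ (hU : ContDiff ℝ 2 P.U) (hV : ContDiff ℝ 2 P.V) (N : ℕ)
    (x : PhaseSpace N) (j : Fin N) :
    HasLineDerivAt ℝ (P.drift N)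
      ((Pi.single j 1, fun i => if i = j then -(P.γ * bathWeight N i) else 0) : PhaseSpace N)
      x (unitP j) := by
  unfold HasLineDerivAt
  rw [P.drift_eq (hU.differentiable (by norm_num)) (hV.differentiable (by norm_num))]
  simp only [unitP_eq, add_smul_unitP_fst, add_smul_unitP_snd]
  have hlin : HasDerivAt (fun t : ℝ => x.2 + t • (Pi.single j (1 : ℝ) : Fin N → ℝ))
      (Pi.single j 1) 0 := by
    simpa using ((hasDerivAt_id (0 : ℝ)).smul_const (Pi.single j (1 : ℝ) : Fin N → ℝ)).const_add
      x.2
  have hco : ∀ m : Fin N, HasDerivAt (fun t : ℝ => (x.2 + t • (Pi.single j (1 : ℝ) : Fin N → ℝ)) m)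
      (if m = j then 1 else 0) 0 := fun m => by
    have := (hasDerivAt_pi.1 hlin) m
    simpa [Pi.single_apply] using this
  refine hlin.prodMk (hasDerivAt_pi.2 fun i => ?_)
  have h2 := ((hco i).const_mul (P.γ * bathWeight N i)).const_sub (-P.dPotential N i x.1)
  convert h2 using 1
  split_ifs <;> ring

/-- `∂Y/∂q_j = (0, -(∂²Φ/∂q_j∂q_i)_i)` for `C²` potentials. [folklore] -/
theorem hasLineDerivAt_drift_unitQ₂ (hU : ContDiff ℝ 2 P.U) (hV : ContDiff ℝ 2 P.V) (N : ℕ)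
    (x : PhaseSpace N) (j : Fin N) :
    HasLineDerivAt ℝ (P.drift N) ((0, fun i => -P.hessPotential N i j x.1) : PhaseSpace N)
      x (unitQ j) := by
  unfold HasLineDerivAt
  rw [P.drift_eq (hU.differentiable (by norm_num)) (hV.differentiable (by norm_num))]
  simp only [unitQ_eq, add_smul_unitQ_fst, add_smul_unitQ_snd]
  refine (hasDerivAt_const (0 : ℝ) x.2).prodMk (hasDerivAt_pi.2 fun i => ?_)
  have h2 : (2 : WithTop ℕ∞) = 1 + 1 := by norm_num
  rw [h2] at hU hV
  have hU2 : Differentiable ℝ (deriv P.U) := hU.deriv'.differentiable (by norm_num)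
  have hV2 : Differentiable ℝ (deriv P.V) := hV.deriv'.differentiable (by norm_num)
  have h := (P.hasDerivAt_dPotential_add_smul hU2 hV2 N x.1 i j).neg.sub_const
    (P.γ * bathWeight N i * x.2 i)
  simpa using h

/-- **The derivative of the drift for `C²` potentials**: `DY(x) v = (v.2, -Hess Φ(q) v.1 - γ1_B v.2)`.
[folklore] -/
theorem fderiv_drift_apply₂ (hU : ContDiff ℝ 2 P.U) (hV : ContDiff ℝ 2 P.V) (N : ℕ)
    (x v : PhaseSpace N) :
    fderiv ℝ (P.drift N) x v =
      (v.2, fun i => -(∑ j, P.hessPotential N i j x.1 * v.1 j) - P.γ * bathWeight N i * v.2 i) := by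
  have hd : DifferentiableAt ℝ (P.drift N) x :=
    ((P.contDiff_one_drift hU hV N).differentiable (by norm_num)) x
  have hQ : ∀ j, fderiv ℝ (P.drift N) x (unitQ j) =
      ((0, fun i => -P.hessPotential N i j x.1) : PhaseSpace N) := fun j => by
    rw [← hd.lineDeriv_eq_fderiv]
    exact (P.hasLineDerivAt_drift_unitQ₂ hU hV N x j).lineDeriv
  have hP : ∀ j, fderiv ℝ (P.drift N) x (unitP j) =
      ((Pi.single j 1, fun i => if i = j then -(P.γ * bathWeight N i) else 0) : PhaseSpace N) :=
    fun j => by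
    rw [← hd.lineDeriv_eq_fderiv]
    exact (P.hasLineDerivAt_drift_unitP₂ hU hV N x j).lineDeriv
  rw [clm_apply_eq_sum]
  simp only [hQ, hP]
  ext i
  · simp [Prod.fst_sum, Finset.sum_apply, Pi.single_apply]
  · simp only [Prod.snd_add, Prod.snd_sum, Prod.smul_snd, Finset.sum_apply, Pi.add_apply,
      Pi.smul_apply, smul_eq_mul, mul_neg, Finset.sum_neg_distrib, mul_ite, mul_zero,
      Finset.sum_ite_eq, Finset.mem_univ, if_true]
    rw [Finset.sum_congr rfl fun j _ => mul_comm (v.1 j) (P.hessPotential N i j x.1)]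
    ring

/-- The linearised drift on a momentum direction: `DY(x)(0, e_j) = (e_j, 0) - γ W_j (0, e_j)`.
[folklore] -/
theorem fderiv_drift_unitP₂ (hU : ContDiff ℝ 2 P.U) (hV : ContDiff ℝ 2 P.V) (N : ℕ)
    (x : PhaseSpace N) (j : Fin N) :
    fderiv ℝ (P.drift N) x (unitP j) = unitQ j - (P.γ * bathWeight N j) • unitP j := by
  rw [P.fderiv_drift_apply₂ hU hV N x (unitP j)]
  ext i
  · simp [unitQ, unitP]
  · simp only [Pi.zero_apply, mul_zero, Finset.sum_const_zero, neg_zero,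
      zero_sub, unitQ, unitP, Prod.snd_sub, Prod.smul_snd, Pi.sub_apply, Pi.smul_apply,
      Pi.single_apply, smul_eq_mul, mul_ite, mul_one, mul_zero]
    split_ifs with hij
    · subst hij; simp
    · simp

/-- The linearised drift on a position direction: `DY(x)(e_j, 0) = -∑_i H_{ij}(q) (0, e_i)`.
[folklore] -/
theorem fderiv_drift_unitQ₂ (hU : ContDiff ℝ 2 P.U) (hV : ContDiff ℝ 2 P.V) (N : ℕ)
    (x : PhaseSpace N) (j : Fin N) :
    fderiv ℝ (P.drift N) x (unitQ j) = -∑ i, P.hessPotential N i j x.1 • unitP i := by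
  rw [P.fderiv_drift_apply₂ hU hV N x (unitQ j)]
  ext i
  · simp [unitQ, unitP, Prod.fst_sum]
  · simp only [unitQ_fst, unitQ_snd, Pi.zero_apply, mul_zero, sub_zero, Prod.snd_neg,
      Prod.snd_sum, Pi.neg_apply, Finset.sum_apply, Prod.smul_snd, unitP_snd, Pi.smul_apply,
      Pi.single_apply, smul_eq_mul, mul_ite, mul_one, mul_zero, Finset.sum_ite_eq,
      Finset.sum_ite_eq', Finset.mem_univ, if_true]

/-- The sub-diagonal of the Hessian at the equilibrium: `Hess Φ(0)_{j+1, j} = -V''(0)`. [folklore] -/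
theorem hessPotential_succ_zero (N : ℕ) {i j : Fin N} (h : i.val = j.val + 1) :
    P.hessPotential N i j 0 = -deriv (deriv P.V) 0 := by
  rw [P.hessPotential_succ N h, Pi.zero_apply, Pi.zero_apply, sub_zero]

/-! ### Kalman's condition by peeling -/

/-- **Kalman's rank condition for the linearised chain, from the left bath** (`C²` potentials,
`V''(0) ≠ 0`, `N ≥ 1`): if a linear functional `ℓ` annihilates all the vectors `Aᵏ (0, e₀)`,
`A = DY(0)`, then `ℓ = 0`; equivalently these vectors span phase space — the chain linearised at
its equilibrium is controllable by forcing the momentum of its left end alone, whatever the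
pinning (in particular for the Hairer–Mattingly chain, whose linearisation at `0` is unpinned).
[folklore] -/
theorem eq_zero_of_forall_pow_unitP_zero₂ (hU : ContDiff ℝ 2 P.U) (hV : ContDiff ℝ 2 P.V)
    (hV0 : deriv (deriv P.V) 0 ≠ 0) (hN : 0 < N) (ℓ : PhaseSpace N →ₗ[ℝ] ℝ)
    (h : ∀ k : ℕ, ℓ (((fderiv ℝ (P.drift N) 0) ^ k) (unitP ⟨0, hN⟩)) = 0) :
    ℓ = 0 := by
  set A : PhaseSpace N →L[ℝ] PhaseSpace N := fderiv ℝ (P.drift N) 0 with hA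
  -- the coefficient sequences
  set c : ℕ → Fin N → ℝ := fun k j => ℓ ((A ^ k) (unitP j)) with hc
  set a : ℕ → Fin N → ℝ := fun k j => ℓ ((A ^ k) (unitQ j)) with ha
  -- the recurrences
  have hpow : ∀ (k : ℕ) (v : PhaseSpace N), (A ^ (k + 1)) v = (A ^ k) (A v) := fun k v => by
    rw [pow_succ]
    rfl
  have hrecP : ∀ k j, c (k + 1) j = a k j - P.γ * bathWeight N j * c k j := by
    intro k j
    simp only [hc, ha]
    rw [hpow, hA, P.fderiv_drift_unitP₂ hU hV N 0 j, map_sub, map_smul, map_sub,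
      map_smul, smul_eq_mul]
  have hrecQ : ∀ k j, a (k + 1) j = -∑ i, P.hessPotential N i j 0 * c k i := by
    intro k j
    simp only [hc, ha]
    rw [hpow, hA, P.fderiv_drift_unitQ₂ hU hV N 0 j, map_neg, map_sum, map_neg,
      map_sum]
    congr 1
    refine Finset.sum_congr rfl fun i _ => ?_
    rw [map_smul, map_smul, smul_eq_mul, Prod.fst_zero]
  -- the hypothesis: `c k 0 = 0`
  have hc0 : ∀ k, c k ⟨0, hN⟩ = 0 := h
  -- `a k j = 0` once `c` vanishes at `j`
  have ha_of_c : ∀ j, (∀ k, c k j = 0) → ∀ k, a k j = 0 := by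
    intro j hj k
    have := hrecP k j
    rw [hj (k + 1), hj k] at this
    linarith
  -- peeling induction on the site
  have hpeel : ∀ s : ℕ, ∀ j : Fin N, j.val ≤ s → ∀ k, c k j = 0 := by
    intro s
    induction s with
    | zero =>
      intro j hj k
      have : j = ⟨0, hN⟩ := Fin.ext (Nat.le_zero.mp hj)
      rw [this]
      exact hc0 k
    | succ s ih =>
      intro j hj
      by_cases hj' : j.val ≤ s
      · exact ih j hj'
      · have hjs : j.val = s + 1 := by omega
        have hslt : s < N := by omega
        set j₀ : Fin N := ⟨s, hslt⟩ with hj₀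
        intro k
        have h1 : a (k + 1) j₀ = 0 := ha_of_c j₀ (ih j₀ (by simp [hj₀])) (k + 1)
        rw [hrecQ k j₀] at h1
        have hsum : ∑ i, P.hessPotential N i j₀ 0 * c k i = P.hessPotential N j j₀ 0 * c k j := by
          refine Finset.sum_eq_single j (fun i _ hij => ?_) (by simp)
          by_cases his : i.val ≤ s
          · rw [ih i his k, mul_zero]
          · have hfar : j₀.val + 2 ≤ i.val := by
              have : i.val ≠ s + 1 := fun e => hij (Fin.ext (by rw [e, hjs]))
              simp only [hj₀]
              omega
            rw [P.hessPotential_eq_zero_of_le N hfar, zero_mul]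
        rw [hsum, P.hessPotential_succ_zero N (by rw [hjs]), neg_mul, neg_neg] at h1
        exact (mul_eq_zero.1 h1).resolve_left hV0
  have hcall : ∀ j k, c k j = 0 := fun j k => hpeel j.val j le_rfl k
  have haall : ∀ j k, a k j = 0 := fun j => ha_of_c j fun k => hcall j k
  -- conclude on the basis
  refine LinearMap.ext fun v => ?_
  rw [eq_sum_unitQ_add_sum_unitP v, map_add, map_sum, map_sum]
  simp only [map_smul, smul_eq_mul, LinearMap.zero_apply]
  have hQ : ∀ i, ℓ (unitQ i) = 0 := fun i => by simpa [ha] using haall i 0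
  have hP' : ∀ i, ℓ (unitP i) = 0 := fun i => by simpa [hc] using hcall i 0
  simp [hQ, hP']

end OscillatorChain

end Literature.MathematicalPhysics.KineticTheory.HeatConduction

end
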